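import Literature.NumberTheory.EllipticCurves.GlobalMinimalModel
import Literature.NumberTheory.EllipticCurves.ModularCurve
import Mathlib.Algebra.Module.ZLattice.Covolume
import Mathlib.Analysis.SpecialFunctions.Pow.Real
import HarnessLib

/-!
# Silverman 1986 / Pasten 2024: `log |Δ_min| ≤ 12 h_F(E) + 16` and the `log log` comparison of
# `h_F(E)` with `(1/12) log max(|Δ_min|, |c₄|³)` — Néron-lattice form

Topic `Literature/NumberTheory/EllipticCurves`; named facts (results in print, `def … : Prop`,
D-0014) requested by `wi-09542` for route `ABC/IsogenyGlueCongruence` (its `Assembly`, step (5),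
and the support item `PolyAbcOfPolyDegree` = `stmt-ABC-2048`: "the archimedean fact
`|Δ_min|·covol(Λ_E)⁶ ≪ 1` (Silverman: `log|Δ_E| ≤ 12 h(E) + 16`) gives `|Δ_min| ≪ deg⁶`"), refining
the `ε`-loss fact `silverman1986_discriminant_c4_covolume` of `SilvermanHeightCovolume.lean`
(`max(|Δ|, |c₄|³) ≤ A_ε covol^{-(6+ε)}`) to the sharp forms the route consumes:
NO loss for `|Δ_min|` and a `(log)⁶` loss for `|c₄|³`.

**Sources (held and read).**
* J. H. Silverman, *Heights and elliptic curves*, in Cornell–Silverman (eds.), *Arithmetic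
  Geometry*, Springer 1986, Ch. X (book pp. 253–265 = held volume pp. 330–334):
  Prop. 1.1 (`12 h(E/ℚ) = log|Δ_{E/ℚ}| − log(|Δ(τ)|(Im τ)⁶)`), Remark 1.2, §2 eq. (4)–(8),
  Prop. 2.1, Cor. 2.3 and ITS PROOF (p. 334, display):
  `O(1) ≤ log max{|jΔ|, |Δ|} − 12 h(E/ℚ) ≤ 6 log(1 + h(j)) + O(1)` together with
  `h(j) ≤ log max{|jΔ|, |Δ|}`, where `Δ, c₄, c₆ ∈ ℤ` belong to a MINIMAL Weierstrass equation,
  `jΔ = c₄³`, the `O(1)` are absolute; and §3 eq. (14):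
  `h(E/ℚ) = −½ log((i/2) ∫_{E(ℂ)} α_E ∧ ᾱ_E)` for the Néron differential `α_E` of a minimal
  equation.
* H. Pasten, *Shimura curves and the abc conjecture*, J. Number Theory 254 (2024) = arXiv:1705.09251,
  §3 (definition `h(E) = −½ log((i/2)∫ ω_E ∧ ω̄_E)` and the display `log Δ_E ≤ 12 h(E) + 16`,
  "by a formula of Silverman") and §18.1, Lemma 18.1 (`(1/[L:ℚ]) log Δ_E < 12 h(E) + 16`, from
  Silverman's Prop. 1.1 with the `(2π)`-normalisation of `Δ(τ)` corrected).

**The dictionary.** For a global minimal model `W/ℚ` and a period pair `L` spanning its Néron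
lattice `Λ` (`IsNeronLatticeOf (W.baseChange ℂ) L`: `g₂(L) = c₄/12`, `g₃(L) = c₆/216`, the lattice
of the Néron differential `α_E`), `(i/2)∫_{E(ℂ)} α_E ∧ ᾱ_E = ∫_{ℂ/Λ} dx dy = covol(Λ)` (Silverman,
proof of Prop. 1.1, p. 332: "the area of a fundamental parallelogram"), so
`h(E/ℚ) = −½ log covol(Λ)`; this number is `neronLatticeHeight L` below, and the printed
inequalities become statements about `W.Δ`, `W.c₄` and `ZLattice.covolume L.lattice`.

## Contents

* `neronLatticeHeight L = −½ log covol(L.lattice)` (definition; Silverman (14) / Pasten §3).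
* `pasten2024_log_minimalDiscriminant_le` — FACT: `log|Δ_W| ≤ 12 h + 16` (Pasten 2024, §3 and
  Lemma 18.1; Silverman 1986 Prop. 1.1). PROVED corollary `….covolume_form`:
  `|Δ_W| · covol(L.lattice)⁶ ≤ e¹⁶`.
* `silverman1986_log_max_sub_height` — FACT (two-sided, absolute constants `C₀, C₁`):
  `C₀ ≤ log max(|Δ_W|, |c₄(W)|³) − 12 h ≤ 6 log(1 + log max(|Δ_W|, |c₄(W)|³)) + C₁`
  (Silverman 1986, proof of Cor. 2.3 with (14), `h(j)` majorised by `log max{|jΔ|, |Δ|}` as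
  printed there). PROVED corollaries: `….max_covolume_form`
  (`max(|Δ|,|c₄|³)·covol⁶ ≤ e^{C₁}(1 + log max)⁶`), `….c4_covolume_form` (the route's
  `|c₄|³·covol⁶ ≤ C₂(1 + log max(|Δ_min|, |c₄|³))⁶`) and `….covolume_lower_form`
  (`e^{C₀} ≤ max(|Δ|,|c₄|³)·covol⁶`).

## Rendering choices

* As in `SilvermanHeightCovolume.lean`: `W : WeierstrassCurve ℚ` elliptic and `IsGloballyMinimal`
  (so `W.Δ = Δ_min`, `|W.Δ| ≥ 1`, and `c₄(W)` is the `c₄` of a minimal equation), `L : PeriodPair`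
  with `IsNeronLatticeOf (W.baseChange ℂ) L`, `covol = ZLattice.covolume L.lattice` (Lebesgue area of
  a fundamental parallelogram).
* Pasten's constant `16` is kept verbatim (his `h` is Silverman's non-stabilised `h(E/ℚ)`, (14));
  Silverman's `O(1)`'s are existentially quantified absolute constants.
* Not here: the number-field versions (Prop. 1.1/2.1 for `K ≠ ℚ`, Pasten Lemma 18.1 for `L ≠ ℚ`),
  the Weil height `h(j)` itself (only its printed majorant `log max{|jΔ|, |Δ|}` is used), the
  `|c₆|²` display of Cor. 2.3 (see `silverman1986_c6_covolume`).

## References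

* J. H. Silverman, *Heights and elliptic curves*, Arithmetic Geometry (Cornell–Silverman eds.),
  Springer (1986) 253–265: Prop. 1.1, Remark 1.2, (4)–(8), Prop. 2.1, Cor. 2.3 (with proof), (14).
  [`Silverman1986`]
* H. Pasten, *Shimura curves and the abc conjecture*, J. Number Theory 254 (2024) 214–335,
  arXiv:1705.09251: §3 (`log Δ_E ≤ 12h(E) + 16`), §18.1 Lemma 18.1. [`PastenShimura2024`]
-/

noncomputable section

namespace Literature.NumberTheory.EllipticCurves.ModularForms

open WeierstrassCurve

/-! ### The Faltings height read off the Néron lattice -/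

/-- The **height attached to a period lattice**, `−½ log covol(Λ)`: for an elliptic curve `E/ℚ`
and `L` a period pair spanning the Néron lattice `Λ` of a global minimal model
(`IsNeronLatticeOf`), this is the (non-stabilised) Faltings height
`h(E/ℚ) = −½ log((i/2)∫_{E(ℂ)} α_E ∧ ᾱ_E)` of Silverman 1986, (14) / Pasten 2024, §3, because
`(i/2)∫ α_E ∧ ᾱ_E` is the area `covol(Λ)` of a fundamental parallelogram (Silverman, proof of
Prop. 1.1). Defined for every period pair (no minimality is needed to state it).
[cite: Silverman1986, §3 eq. (14)] -/
def neronLatticeHeight (L : PeriodPair) : ℝ :=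
  -(1 / 2) * Real.log (ZLattice.covolume L.lattice)

/-- Unfolding `neronLatticeHeight`: `12 h = −6 log covol(Λ)`. [folklore] -/
theorem twelve_mul_neronLatticeHeight (L : PeriodPair) :
    12 * neronLatticeHeight L = -6 * Real.log (ZLattice.covolume L.lattice) := by
  rw [neronLatticeHeight]; ring

/-- For a globally minimal elliptic `W/ℚ`, `|Δ_W| ≥ 1` (it is a nonzero integer,
`minimalDiscriminantInt`). [folklore] -/
theorem one_le_abs_Δ (W : WeierstrassCurve ℚ) [W.IsElliptic] [W.IsGloballyMinimal] :
    (1 : ℝ) ≤ |((W.Δ : ℚ) : ℝ)| := by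
  rw [← cast_minimalDiscriminantInt W, Rat.cast_intCast, ← Int.cast_abs, ← Int.cast_one,
    Int.cast_le]
  exact Int.one_le_abs (minimalDiscriminantInt_ne_zero W)

/-! ### Pasten 2024 / Silverman 1986: `log |Δ_min| ≤ 12 h + 16` -/

/-- **`log |Δ_E| ≤ 12 h(E) + 16`** (Pasten 2024, §3, "by a formula of Silverman", and §18.1,
Lemma 18.1 for `L = ℚ`: `log Δ_E < 12 h(E) + 16`; from Silverman 1986, Prop. 1.1
`12 h(E/ℚ) = log|Δ_{E/ℚ}| − log(|Δ(τ)|(Im τ)⁶)` and the boundedness of the `SL₂(ℤ)`-invariant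
function `|Δ(τ)|(Im τ)⁶` on `ℍ`, Remark 1.2 (2) and (4)). Here `Δ_E = |Δ_W|` is the minimal
discriminant of `E/ℚ` (the discriminant of the global minimal model `W`) and
`h(E) = neronLatticeHeight L = −½ log covol(Λ_Néron)` (Silverman (14)). Printed with `<`; we state
`≤`. [cite: PastenShimura2024, §3 (display log Δ_E ≤ 12h(E)+16) and Lemma 18.1] -/
def pasten2024_log_minimalDiscriminant_le : Prop :=
  ∀ (W : WeierstrassCurve ℚ) [W.IsElliptic] [W.IsGloballyMinimal] (L : PeriodPair),
    IsNeronLatticeOf (W.baseChange ℂ) L →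
      Real.log |((W.Δ : ℚ) : ℝ)| ≤ 12 * neronLatticeHeight L + 16

/-- **Covolume form** of `log|Δ_E| ≤ 12 h(E) + 16`: `|Δ_min| · covol(Λ_Néron)⁶ ≤ e¹⁶` — the shape
used by route `IsogenyGlueCongruence` ("`|Δ_min|·covol(Λ_E)⁶ ≪ 1`"). PROVED from the fact by
exponentiating (`|Δ_W| ≥ 1`, `covol > 0`). [cite: PastenShimura2024, §3 (display log Δ_E ≤ 12h(E)+16)] -/
theorem pasten2024_log_minimalDiscriminant_le.covolume_form
    (h : pasten2024_log_minimalDiscriminant_le) (W : WeierstrassCurve ℚ) [W.IsElliptic]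
    [W.IsGloballyMinimal] (L : PeriodPair) (hL : IsNeronLatticeOf (W.baseChange ℂ) L) :
    |((W.Δ : ℚ) : ℝ)| * ZLattice.covolume L.lattice ^ 6 ≤ Real.exp 16 := by
  have hcov : 0 < ZLattice.covolume L.lattice := ZLattice.covolume_pos L.lattice _
  have hΔ : 0 < |((W.Δ : ℚ) : ℝ)| := lt_of_lt_of_le one_pos (one_le_abs_Δ W)
  have h1 := h W L hL
  rw [twelve_mul_neronLatticeHeight] at h1
  have h2 : Real.log (|((W.Δ : ℚ) : ℝ)| * ZLattice.covolume L.lattice ^ 6) ≤ 16 := by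
    rw [Real.log_mul hΔ.ne' (pow_ne_zero 6 hcov.ne'), Real.log_pow]
    push_cast
    linarith
  exact (Real.log_le_iff_le_exp (mul_pos hΔ (pow_pos hcov 6))).1 h2

/-! ### Silverman 1986: `h(E/ℚ)` versus `(1/12) log max(|Δ|, |c₄|³)`, with a `log log` error -/

/-- **Silverman 1986, proof of Cor. 2.3 (p. 334) with Prop. 2.1 and (14).** There are absolute
constants `C₀, C₁` such that for every elliptic curve `E/ℚ` with global minimal model `W`
(`Δ = Δ_W`, `c₄ = c₄(W) ∈ ℤ`, `jΔ = c₄³`) and every period pair `L` spanning its Néron lattice,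
with `h = h(E/ℚ) = neronLatticeHeight L` and `M = max(|Δ|, |c₄|³) = max{|Δ|, |jΔ|}`:
`C₀ ≤ log M − 12 h ≤ 6 log(1 + log M) + C₁`.
Printed: "`O(1) ≤ log max{|jΔ|, |Δ|} − 12h(E/ℚ) ≤ 6 log(1 + h(j)) + O(1)`" and
"`h(j) ≤ log max{|jΔ|, |Δ|}`" (proof of Cor. 2.3), with `h` given by (14); we have substituted the
printed majorant for the Weil height `h(j)` (monotonicity of `log(1 + ·)`), so this is implied by
the text. Note `M ≥ |Δ| ≥ 1`, so `log M ≥ 0`. [cite: Silverman1986, Cor. 2.3 (proof, p. 334) with Prop. 2.1 and (14)] -/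
def silverman1986_log_max_sub_height : Prop :=
  ∃ C₀ C₁ : ℝ, ∀ (W : WeierstrassCurve ℚ) [W.IsElliptic] [W.IsGloballyMinimal] (L : PeriodPair),
    IsNeronLatticeOf (W.baseChange ℂ) L →
      C₀ ≤ Real.log ((max |W.Δ| (|W.c₄| ^ 3) : ℚ) : ℝ) - 12 * neronLatticeHeight L ∧
      Real.log ((max |W.Δ| (|W.c₄| ^ 3) : ℚ) : ℝ) - 12 * neronLatticeHeight L ≤
        6 * Real.log (1 + Real.log ((max |W.Δ| (|W.c₄| ^ 3) : ℚ) : ℝ)) + C₁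

/-- `M = max(|Δ_W|, |c₄(W)|³) ≥ 1` for a globally minimal elliptic `W/ℚ`. [folklore] -/
theorem one_le_max_abs_Δ_c4 (W : WeierstrassCurve ℚ) [W.IsElliptic] [W.IsGloballyMinimal] :
    (1 : ℝ) ≤ ((max |W.Δ| (|W.c₄| ^ 3) : ℚ) : ℝ) := by
  rw [Rat.cast_max, Rat.cast_abs]
  exact (one_le_abs_Δ W).trans (le_max_left _ _)

/-- **Covolume form, upper bound**: `max(|Δ_W|, |c₄(W)|³) · covol(Λ)⁶ ≤ e^{C₁} (1 + log max)⁶`.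
PROVED from `silverman1986_log_max_sub_height` by exponentiating.
[cite: Silverman1986, Cor. 2.3 (proof, p. 334) with (14)] -/
theorem silverman1986_log_max_sub_height.max_covolume_form
    (h : silverman1986_log_max_sub_height) :
    ∃ C : ℝ, ∀ (W : WeierstrassCurve ℚ) [W.IsElliptic] [W.IsGloballyMinimal] (L : PeriodPair),
      IsNeronLatticeOf (W.baseChange ℂ) L →
        ((max |W.Δ| (|W.c₄| ^ 3) : ℚ) : ℝ) * ZLattice.covolume L.lattice ^ 6 ≤
          C * (1 + Real.log ((max |W.Δ| (|W.c₄| ^ 3) : ℚ) : ℝ)) ^ 6 := by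
  obtain ⟨C₀, C₁, hC⟩ := h
  refine ⟨Real.exp C₁, fun W _ _ L hL => ?_⟩
  set M : ℝ := ((max |W.Δ| (|W.c₄| ^ 3) : ℚ) : ℝ) with hM
  have hcov : 0 < ZLattice.covolume L.lattice := ZLattice.covolume_pos L.lattice _
  have hM1 : 1 ≤ M := one_le_max_abs_Δ_c4 W
  have hM0 : 0 < M := lt_of_lt_of_le one_pos hM1
  have hlogM : 0 ≤ Real.log M := Real.log_nonneg hM1
  have hX : 0 < 1 + Real.log M := by linarith
  have h2 := (hC W L hL).2
  rw [twelve_mul_neronLatticeHeight] at h2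
  have h3 : Real.log (M * ZLattice.covolume L.lattice ^ 6) ≤
      Real.log (Real.exp C₁ * (1 + Real.log M) ^ 6) := by
    rw [Real.log_mul hM0.ne' (pow_ne_zero 6 hcov.ne'), Real.log_pow,
      Real.log_mul (Real.exp_pos C₁).ne' (pow_ne_zero 6 hX.ne'), Real.log_exp, Real.log_pow]
    push_cast
    linarith
  exact (Real.log_le_log_iff (mul_pos hM0 (pow_pos hcov 6))
    (mul_pos (Real.exp_pos C₁) (pow_pos hX 6))).1 h3

/-- **Covolume form for `c₄`** — the shape requested by route `IsogenyGlueCongruence`: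
`|c₄(W)|³ · covol(Λ)⁶ ≤ C₂ (1 + log max(|Δ_min|, |c₄|³))⁶` with an absolute constant `C₂`
(the `(log)⁶` loss is genuine: `covol = |ω₁|² Im τ` and `Im τ ≍ log|j|` for large `|j|`,
Silverman (7)). PROVED from `silverman1986_log_max_sub_height`.
[cite: Silverman1986, Cor. 2.3 (proof, p. 334) with (14)] -/
theorem silverman1986_log_max_sub_height.c4_covolume_form
    (h : silverman1986_log_max_sub_height) :
    ∃ C : ℝ, ∀ (W : WeierstrassCurve ℚ) [W.IsElliptic] [W.IsGloballyMinimal] (L : PeriodPair),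
      IsNeronLatticeOf (W.baseChange ℂ) L →
        ((|W.c₄| ^ 3 : ℚ) : ℝ) * ZLattice.covolume L.lattice ^ 6 ≤
          C * (1 + Real.log ((max |W.Δ| (|W.c₄| ^ 3) : ℚ) : ℝ)) ^ 6 := by
  obtain ⟨C, hC⟩ := h.max_covolume_form
  refine ⟨C, fun W _ _ L hL => le_trans ?_ (hC W L hL)⟩
  have hcov : 0 < ZLattice.covolume L.lattice := ZLattice.covolume_pos L.lattice _
  refine mul_le_mul_of_nonneg_right ?_ (pow_pos hcov 6).le
  push_cast
  exact le_max_right _ _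

/-- **Covolume form, lower bound**: `e^{C₀} ≤ max(|Δ_W|, |c₄(W)|³) · covol(Λ)⁶` (the left
inequality `O(1) ≤ log max{|jΔ|,|Δ|} − 12 h(E/ℚ)` of Silverman's proof of Cor. 2.3). PROVED from
`silverman1986_log_max_sub_height`. [cite: Silverman1986, Cor. 2.3 (proof, p. 334) with (14)] -/
theorem silverman1986_log_max_sub_height.covolume_lower_form
    (h : silverman1986_log_max_sub_height) :
    ∃ c : ℝ, 0 < c ∧ ∀ (W : WeierstrassCurve ℚ) [W.IsElliptic] [W.IsGloballyMinimal]
      (L : PeriodPair), IsNeronLatticeOf (W.baseChange ℂ) L →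
        c ≤ ((max |W.Δ| (|W.c₄| ^ 3) : ℚ) : ℝ) * ZLattice.covolume L.lattice ^ 6 := by
  obtain ⟨C₀, C₁, hC⟩ := h
  refine ⟨Real.exp C₀, Real.exp_pos C₀, fun W _ _ L hL => ?_⟩
  set M : ℝ := ((max |W.Δ| (|W.c₄| ^ 3) : ℚ) : ℝ) with hM
  have hcov : 0 < ZLattice.covolume L.lattice := ZLattice.covolume_pos L.lattice _
  have hM0 : 0 < M := lt_of_lt_of_le one_pos (one_le_max_abs_Δ_c4 W)
  have h1 := (hC W L hL).1
  rw [twelve_mul_neronLatticeHeight] at h1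
  have h3 : C₀ ≤ Real.log (M * ZLattice.covolume L.lattice ^ 6) := by
    rw [Real.log_mul hM0.ne' (pow_ne_zero 6 hcov.ne'), Real.log_pow]
    push_cast
    linarith
  exact (Real.le_log_iff_exp_le (mul_pos hM0 (pow_pos hcov 6))).1 h3

end Literature.NumberTheory.EllipticCurves.ModularForms

end
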